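import Summits.BirchSwinnertonDyer.BirchSwinnertonDyer.Theorems.ClassRecordThreeEulerHalvesAtThreeWalkSupplyAtThreeDisplayNamedPrint
import Summits.BirchSwinnertonDyer.BirchSwinnertonDyer.Theorems.ClassRecordThreeEulerHalvesAtThreeGross53Discharged
import Literature.NumberTheory.EllipticCurves.HeegnerPointsOfConductorOneRationalityProofs
import Literature.NumberTheory.EllipticCurves.HeegnerPointsOfConductorOneGaloisConjProofs
import Summits.BirchSwinnertonDyer.Rank1Residual.JET.McCallumProp44ByName
import Summits.BirchSwinnertonDyer.BirchSwinnertonDyer.Theorems.ClassRecordThreeEulerHalvesAtThreeWalkSupplyAtThreeDisplayPrint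
import HarnessLib

/-!
# Crux 19109 `EulerHalvesAtThree`, registered stub `stub_jetchevMaxHLAtThree` (Jetchev 2008 Thm. 1.4 in
# MAX form at `3 ∥ N`): tam3-p1's display `Koly.jetchevMaxHLAtThree_of_facts_of_namedPrint` with THREE of
# its seven print binders SUPPLIED by tree theorems (cell `bsd-stepL`, seat `bsd-stepL-mult-p3`, session g2;
# `--supports stmt-BirchSwinnertonDyer-19109`, helper)

HONEST FRAMING (cell `bsd-stepL`). tam3-p1 g7 (p541099) closed the registered Euler-system stub of crux
19109 MODULO NAMED PRINT ONLY: `Koly.jetchevMaxHLAtThree_of_facts_of_namedPrint` = the stub VERBATIM ⟸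
{seven typed print facts `h52 h44 h53 hD36 hrec hGZ hmod`} + {`hPT` Poitou–Tate for Selmer structures
(conj. form, named fact), `hGZ31` the [GZ86 III (3.1)] receptacle schema (cite-only)}. Three of the seven
print facts are THEOREMS of the tree today and are supplied here, nothing else changing:
* `h53` (Gross 1991 Prop. 5.3 at conductor `n`) = `heegnerPointOfConductor_conj_sub_neg_rootNumber_smul_holds`
  (this seat, `Theorems/ClassRecordThreeEulerHalvesAtThreeGross53Discharged.lean`);
* `hD36` (Darmon 2004 Thm. 3.6 ∕ Gross 1984: `φ(τ) ∈ E(K^{ab})`, singular moduli) =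
  `phi_heegnerTau_mem_singularModuliField_holds` (`HeegnerPointsOfConductorOneRationalityProofs`);
* `hrec` (Darmon Thm. 3.7 ∕ Gross §4 at conductor `1`, Shimura reciprocity) =
  `heegnerPointOfConductor_one_galoisConj_holds` (`HeegnerPointsOfConductorOneGaloisConjProofs`).
So the Jetchev-max input of 19109 now reads ⟸ {McCallum 1991 Prop. 5.2 (`h52`), Prop. 4.4 (`h44`),
Gross–Zagier (`hGZ`), modularity (`hmod`)} + {`hPT`, `hGZ31`}. CONDITIONAL on those six binders; item
19109 NOT closed; nothing booked; 0 classes move (T7).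

ADDENDUM (§2). McCallum Prop. 4.4 (`h44`) itself follows BY NAME from the image-free Eichler–Shimura
congruence Gross 1991 Prop. 3.7 (2) (`GrossLMS1991.prop37_2_frobeniusCongruence`, lit g24 p535266) by bsd-jet's
`JET.prop44_of_frobeniusCongruence` (p542569); §2 re-issues §1 with `h44 := prop44_of_frobeniusCongruence hγ`, so
the Jetchev-max input of 19109 reads ⟸ {McCallum Prop. 5.2, Gross Prop. 3.7 (2), Gross–Zagier, modularity} +
{`hPT`, `hGZ31`} — the same single congruence fact `hγ` on which x11b3's Kolyvagin order bound at 3 rests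
(`Three/KolyvaginShaOrderThreeDischarged`).

ADDENDUM 2 (§3, after RULING 28 ∕ tam3-p1 g8 p547155). The binder `hGZ31` of §1–§2 (the UNGUARDED [GZ86 III (3.1)]
receptacle schema) is FALSE as typed (witness 11a1 ∕ ℚ(√−7) ∕ p = 5, this seat's evidence #47 on 19109; planner RULING 28), so
§1–§2 are VACUOUS in that binder. tam3-p1's re-issue `Koly.jetchevMaxHLAtThree_of_facts_of_print` (p547155) replaces the schema by
the TRUE Literature fact `Gross1991_heegnerPoint_sub_ratTorsion_mem_E0` (hF1; supplier bsd-jet `JET.forall_hGZ_of_Gross1991`) and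
already supplies hD36 ∕ hrec ∕ h53 (the last from bsd-jet's admissible-conductor theorem). §3 re-issues THAT display with h44 fed from
Gross 1991 Prop. 3.7 (2) (`JET.prop44_of_frobeniusCongruence`): the Jetchev-max input of 19109 ⟸ {McCallum Prop. 5.2, Gross Prop. 3.7 (2),
Gross–Zagier, modularity} + {`hPT`, `hF1`} — no schema, no false binder.

References: [Jetchev2008] Thm. 1.4; [McCallumLMS1991] Prop. 4.4, Prop. 5.2; [GrossLMS1991] §4, Prop. 5.3;
[Darmon2004] Thm. 3.6, Thm. 3.7, Prop. 3.11; [GrossZagier1986] Thm. I.(6.3), III (3.1).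
-/

set_option autoImplicit false

noncomputable section

open scoped Classical NumberField

namespace Summit.BirchSwinnertonDyer.Rank1Residual.X11b.Three.Koly

open WeierstrassCurve NumberField IsDedekindDomain Literature.NumberTheory.EllipticCurves
  Literature.NumberTheory.EllipticCurves.ModularForms Literature.NumberTheory.EllipticCurves.Rank1Residual
  Literature.NumberTheory.GaloisRepresentations Literature.NumberTheory.GaloisCohomology
  Summit.BirchSwinnertonDyer.Rank1Residual Summit.BirchSwinnertonDyer.Rank1Residual.X11b

/-- **`stub_jetchevMaxHLAtThree` ⟸ {McCallum Prop. 5.2, Prop. 4.4, Gross–Zagier, modularity} + {`hPT`,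
`hGZ31`}** — tam3-p1's `jetchevMaxHLAtThree_of_facts_of_namedPrint` with `h53` (Gross Prop. 5.3, this
seat's discharge), `hD36` (Darmon Thm. 3.6) and `hrec` (Shimura reciprocity at conductor `1`) supplied by
the tree theorems `heegnerPointOfConductor_conj_sub_neg_rootNumber_smul_holds`,
`phi_heegnerTau_mem_singularModuliField_holds`, `heegnerPointOfConductor_one_galoisConj_holds`.
Conclusion VERBATIM the registered stub's (the MAX-form Jetchev divisibility `PDiv d 3 s` at every
Hoffstein–Luo A1-type frame with `3 ∤ c(Dt)` and every admissible conductor). CONDITIONAL; nothing booked.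
[cite: Jetchev2008, Thm. 1.4] [cite: McCallumLMS1991, Prop. 4.4, Prop. 5.2] [cite: GrossLMS1991, Prop. 5.3]
[cite: Darmon2004, Thm. 3.6, Thm. 3.7] -/
theorem jetchevMaxHLAtThree_of_namedPrint_discharged
    -- PRINT FACTS (typed) still carried
    (h52 : McCallum1991.prop52_exists_conductor_kolyvaginClass_order_eq)
    (h44 : McCallum1991.prop44_localOrder_kolyvaginClass_mul_eq)
    (hGZ : ∀ (N : ℕ) [NeZero N] (W : WeierstrassCurve ℚ) (K : Type) [Field K] [NumberField K],
      gross_zagier N W K)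
    (hmod : hasEntireLFunction_rat)
    -- NAMED PRINT (cite-only)
    (hPT : ∀ (K : Type) [Field K] [NumberField K], poitouTate_selmerStructure_duality_conj K)
    (hGZ31 : ∀ (W : WeierstrassCurve ℚ) [W.IsElliptic] [NeZero (W.conductorNorm ℤ)]
      (K : Type) [Field K] [NumberField K] (p : ℕ) [Fact p.Prime]
      (Dt : ModularParametrizationData W (W.conductorNorm ℤ)) (β : ℤ) (ι : K →+* ℂ)
      [∀ j : ℕ, NumberField (ringClassField K ι j)],
      ∃ n' : ℤ, IsCoprime (p : ℤ) n' ∧ ∀ (m : ℕ) (dm : KolyvaginHeegnerData Dt β ι m)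
        (γ : ringClassField K ι m ≃ₐ[ℚ] ringClassField K ι m), γ ∈ ringClassGal ι m →
        ∀ v : HeightOneSpectrum (𝓞 K), ¬ (W.baseChange K).HasGoodReductionAt v →
          n' • pointsMap (W.baseChange K) (v.adicCompletion K)
              (dm.toGeomPoints (pointGalHom W (ringClassField K ι m) γ dm.y)) ∈
            E0Receptacle (W.baseChange K) v ∧
          ∀ (ℓ : ℕ), ℓ ∈ m.primeFactors → ∀ (dm' : KolyvaginHeegnerData Dt β ι (m / ℓ))
            (hle : ringClassField K ι (m / ℓ) ≤ ringClassField K ι m),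
            n' • pointsMap (W.baseChange K) (v.adicCompletion K)
                (dm.toGeomPoints (pointGalHom W (ringClassField K ι m) γ
                  (WeierstrassCurve.Affine.Point.map (W' := W)
                    ((RingClassField.inclusion ι hle).restrictScalars ℚ) dm'.y))) ∈
              E0Receptacle (W.baseChange K) v) :
    ∀ (W : WeierstrassCurve ℚ) [W.IsElliptic] [W.IsGloballyMinimal] [NeZero (W.conductorNorm ℤ)]
      (K : Type) [Field K] [NumberField K]
      (Dt : ModularParametrizationData W (W.conductorNorm ℤ)) (β : ℤ) (ι : K →+* ℂ),
      W.analyticRank = 1 → W.HasMultiplicativeReductionAtPrime 3 → Surj W 3 →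
      IsImaginaryQuadratic K → SatisfiesHeegnerHypothesis (W.conductorNorm ℤ) K →
      Odd (NumberField.discr K) → (W.quadraticTwist (NumberField.discr K : ℚ)).entireLFunction 1 ≠ 0 →
      (4 * (W.conductorNorm ℤ : ℤ)) ∣ β ^ 2 - NumberField.discr K → ¬ (3 : ℤ) ∣ Dt.c →
      ∀ (v : HeightOneSpectrum (𝓞 ℚ)) (s : ℕ), s ≤ padicValNat 3 (W.tamagawaNumberAt v) →
        ∀ (n : ℕ) (d : KolyvaginHeegnerData Dt β ι n), Squarefree n →
          (∀ ℓ ∈ n.primeFactors, Zhang2014.IsKolyvaginPrime (W.conductorNorm ℤ) W K 3 ℓ ∧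
            s ≤ Zhang2014.kolyvaginIndex W 3 ℓ) → PDiv d 3 s :=
  jetchevMaxHLAtThree_of_facts_of_namedPrint h52 h44
    (fun W K _ _ ↦ heegnerPointOfConductor_conj_sub_neg_rootNumber_smul_holds W K)
    (fun N _ W K _ _ ↦ phi_heegnerTau_mem_singularModuliField_holds N W K)
    (fun N _ W K _ _ ↦ heegnerPointOfConductor_one_galoisConj_holds N W K) hGZ hmod hPT hGZ31

/-! ### §2 With McCallum Prop. 4.4 fed from Gross Prop. 3.7 (2) (bsd-jet's `prop44_of_frobeniusCongruence`) -/

/-- **`stub_jetchevMaxHLAtThree` ⟸ {McCallum Prop. 5.2, Gross 1991 Prop. 3.7 (2), Gross–Zagier, modularity} +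
{`hPT`, `hGZ31`}** — §1 with `h44` (McCallum Prop. 4.4) supplied from the image-free Frobenius ∕ Eichler–Shimura
congruence fact `GrossLMS1991.prop37_2_frobeniusCongruence` via bsd-jet's
`JET.prop44_of_frobeniusCongruence`. Conclusion VERBATIM the registered stub's. CONDITIONAL on the six
binders; nothing booked. [cite: Jetchev2008, Thm. 1.4] [cite: McCallumLMS1991, Prop. 4.4, Prop. 5.2]
[cite: GrossLMS1991, Prop. 3.7 (2), Prop. 5.3] [cite: Darmon2004, Thm. 3.6, Thm. 3.7] -/
theorem jetchevMaxHLAtThree_of_frobeniusCongruence_discharged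
    -- PRINT FACTS (typed) still carried
    (h52 : McCallum1991.prop52_exists_conductor_kolyvaginClass_order_eq)
    (hγ : GrossLMS1991.prop37_2_frobeniusCongruence)
    (hGZ : ∀ (N : ℕ) [NeZero N] (W : WeierstrassCurve ℚ) (K : Type) [Field K] [NumberField K],
      gross_zagier N W K)
    (hmod : hasEntireLFunction_rat)
    -- NAMED PRINT (cite-only)
    (hPT : ∀ (K : Type) [Field K] [NumberField K], poitouTate_selmerStructure_duality_conj K)
    (hGZ31 : ∀ (W : WeierstrassCurve ℚ) [W.IsElliptic] [NeZero (W.conductorNorm ℤ)]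
      (K : Type) [Field K] [NumberField K] (p : ℕ) [Fact p.Prime]
      (Dt : ModularParametrizationData W (W.conductorNorm ℤ)) (β : ℤ) (ι : K →+* ℂ)
      [∀ j : ℕ, NumberField (ringClassField K ι j)],
      ∃ n' : ℤ, IsCoprime (p : ℤ) n' ∧ ∀ (m : ℕ) (dm : KolyvaginHeegnerData Dt β ι m)
        (γ : ringClassField K ι m ≃ₐ[ℚ] ringClassField K ι m), γ ∈ ringClassGal ι m →
        ∀ v : HeightOneSpectrum (𝓞 K), ¬ (W.baseChange K).HasGoodReductionAt v →
          n' • pointsMap (W.baseChange K) (v.adicCompletion K)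
              (dm.toGeomPoints (pointGalHom W (ringClassField K ι m) γ dm.y)) ∈
            E0Receptacle (W.baseChange K) v ∧
          ∀ (ℓ : ℕ), ℓ ∈ m.primeFactors → ∀ (dm' : KolyvaginHeegnerData Dt β ι (m / ℓ))
            (hle : ringClassField K ι (m / ℓ) ≤ ringClassField K ι m),
            n' • pointsMap (W.baseChange K) (v.adicCompletion K)
                (dm.toGeomPoints (pointGalHom W (ringClassField K ι m) γ
                  (WeierstrassCurve.Affine.Point.map (W' := W)
                    ((RingClassField.inclusion ι hle).restrictScalars ℚ) dm'.y))) ∈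
              E0Receptacle (W.baseChange K) v) :
    ∀ (W : WeierstrassCurve ℚ) [W.IsElliptic] [W.IsGloballyMinimal] [NeZero (W.conductorNorm ℤ)]
      (K : Type) [Field K] [NumberField K]
      (Dt : ModularParametrizationData W (W.conductorNorm ℤ)) (β : ℤ) (ι : K →+* ℂ),
      W.analyticRank = 1 → W.HasMultiplicativeReductionAtPrime 3 → Surj W 3 →
      IsImaginaryQuadratic K → SatisfiesHeegnerHypothesis (W.conductorNorm ℤ) K →
      Odd (NumberField.discr K) → (W.quadraticTwist (NumberField.discr K : ℚ)).entireLFunction 1 ≠ 0 →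
      (4 * (W.conductorNorm ℤ : ℤ)) ∣ β ^ 2 - NumberField.discr K → ¬ (3 : ℤ) ∣ Dt.c →
      ∀ (v : HeightOneSpectrum (𝓞 ℚ)) (s : ℕ), s ≤ padicValNat 3 (W.tamagawaNumberAt v) →
        ∀ (n : ℕ) (d : KolyvaginHeegnerData Dt β ι n), Squarefree n →
          (∀ ℓ ∈ n.primeFactors, Zhang2014.IsKolyvaginPrime (W.conductorNorm ℤ) W K 3 ℓ ∧
            s ≤ Zhang2014.kolyvaginIndex W 3 ℓ) → PDiv d 3 s :=
  jetchevMaxHLAtThree_of_namedPrint_discharged h52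
    (Summit.BirchSwinnertonDyer.Rank1Residual.JET.prop44_of_frobeniusCongruence hγ) hGZ hmod hPT hGZ31

/-! ### §3 On tam3's schema-free display (p547155): McCallum Prop. 4.4 fed from Gross Prop. 3.7 (2) -/

/-- **`stub_jetchevMaxHLAtThree` ⟸ {McCallum Prop. 5.2, Gross 1991 Prop. 3.7 (2), Gross–Zagier, modularity} + {`hPT`, `hF1`}** —
tam3-p1's `Koly.jetchevMaxHLAtThree_of_facts_of_print` (p547155; no receptacle schema: the [GZ86 III (3.1)] input is the
Literature FACT `Gross1991_heegnerPoint_sub_ratTorsion_mem_E0`) with `h44` (McCallum Prop. 4.4) supplied from the image-free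
Frobenius ∕ Eichler–Shimura congruence `GrossLMS1991.prop37_2_frobeniusCongruence` via bsd-jet's `JET.prop44_of_frobeniusCongruence`.
Conclusion VERBATIM the registered stub's. CONDITIONAL on the six binders (all typed published facts); nothing booked.
[cite: Jetchev2008, Thm. 1.4] [cite: McCallumLMS1991, Prop. 4.4, Prop. 5.2] [cite: GrossLMS1991, Prop. 3.7 (2), §6]
[cite: GrossZagier1986, III (3.1)] -/
theorem jetchevMaxHLAtThree_of_print_of_frobeniusCongruence
    (h52 : McCallum1991.prop52_exists_conductor_kolyvaginClass_order_eq)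
    (hγ : GrossLMS1991.prop37_2_frobeniusCongruence)
    (hGZ : ∀ (N : ℕ) [NeZero N] (W : WeierstrassCurve ℚ) (K : Type) [Field K] [NumberField K],
      gross_zagier N W K)
    (hmod : hasEntireLFunction_rat)
    (hPT : ∀ (K : Type) [Field K] [NumberField K], poitouTate_selmerStructure_duality_conj K)
    (hF1 : Gross1991_heegnerPoint_sub_ratTorsion_mem_E0) :
    ∀ (W : WeierstrassCurve ℚ) [W.IsElliptic] [W.IsGloballyMinimal] [NeZero (W.conductorNorm ℤ)]
      (K : Type) [Field K] [NumberField K]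
      (Dt : ModularParametrizationData W (W.conductorNorm ℤ)) (β : ℤ) (ι : K →+* ℂ),
      W.analyticRank = 1 → W.HasMultiplicativeReductionAtPrime 3 → Surj W 3 →
      IsImaginaryQuadratic K → SatisfiesHeegnerHypothesis (W.conductorNorm ℤ) K →
      Odd (NumberField.discr K) → (W.quadraticTwist (NumberField.discr K : ℚ)).entireLFunction 1 ≠ 0 →
      (4 * (W.conductorNorm ℤ : ℤ)) ∣ β ^ 2 - NumberField.discr K → ¬ (3 : ℤ) ∣ Dt.c →
      ∀ (v : HeightOneSpectrum (𝓞 ℚ)) (s : ℕ), s ≤ padicValNat 3 (W.tamagawaNumberAt v) →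
        ∀ (n : ℕ) (d : KolyvaginHeegnerData Dt β ι n), Squarefree n →
          (∀ ℓ ∈ n.primeFactors, Zhang2014.IsKolyvaginPrime (W.conductorNorm ℤ) W K 3 ℓ ∧
            s ≤ Zhang2014.kolyvaginIndex W 3 ℓ) → PDiv d 3 s :=
  jetchevMaxHLAtThree_of_facts_of_print h52
    (Summit.BirchSwinnertonDyer.Rank1Residual.JET.prop44_of_frobeniusCongruence hγ) hGZ hmod hPT hF1

end Summit.BirchSwinnertonDyer.Rank1Residual.X11b.Three.Koly

end
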